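import Summits.Ventures.PercRepro.K4LadderBase

/-!
# PercRepro — the block `M(K₄ ∖ e)`: the base-layer inequality (p9, gen 14; local draft, not filed)

`proofs/P9-S4-KBLOCKS-g14.md` §2: the block `K₄ ∖ e` (rank 3, profiles `(0,3)·1 (1,3)·5 (2,2)·4 (2,3)·8 (3,0)·1 (3,1)·5
(3,2)·8`) has, at the base layer `m = K = p + q − 3` with `c_a = C(K, a)`, `#U = 14c_{q−3} + 12c_{q−2} + 5c_{q−1} + c_q`
and `#Y = A + 5B + 12C + 14D` (the same partial row sums as `K4LadderBase`); the Pascal cube `k4_num_eq` / `k4_den_eq`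
and the reflection are block-independent, and the cross-multiplied difference is `A·(24c₀ + 56c₁ − 80c₃) + rest` with
`A ≥ c₂`, the bound `c₂·coefA + rest = c₃²·G(s,r)/((r+1)(r+2)(r+3))²`, `G` a polynomial with 27 positive monomials
(kblock_poly.py, exact on 625 pairs). With `rls_blockFree_of_baseLayer` and the levels `q ≤ 2` this would close the
`K₄ ∖ e` family at every `m ≥ p + q − 3`. Nothing here is about any window of S4.
-/

namespace PercRepro.LineLadder

open Finset

/-- The `K₄ ∖ e` key identity at the base layer. -/
lemma k4e_key (r s : ℕ) (c0 c1 c2 c3 : ℚ)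
    (qr2 : c2 = c3 * (r + s + 5) / (r + 1)) (qr1 : c1 = c2 * (r + s + 4) / (r + 2))
    (qr0 : c0 = c1 * (r + s + 3) / (r + 3)) :
    c2 * (24 * c0 + 56 * c1 - 80 * c3)
        + (11 * c0 ^ 2 + 21 * c1 * c0 - 32 * c2 * c0 - 21 * c2 * c1 + 21 * c2 ^ 2 - 67 * c3 * c0 + 67 * c3 * c2)
      = c3 ^ 2 * ((156240 + 238008 * (r : ℚ) + 143672 * (r : ℚ)^2 + 42904 * (r : ℚ)^3 + 6328 * (r : ℚ)^4 + 368 * (r : ℚ)^5 + 170268 * (s : ℚ) + 214376 * (s : ℚ) * (r : ℚ) + 103168 * (s : ℚ) * (r : ℚ)^2 + 23200 * (s : ℚ) * (r : ℚ)^3 + 2324 * (s : ℚ) * (r : ℚ)^4 + 72 * (s : ℚ) * (r : ℚ)^5 + 85304 * (s : ℚ)^2 + 86104 * (s : ℚ)^2 * (r : ℚ) + 31354 * (s : ℚ)^2 * (r : ℚ)^2 + 4798 * (s : ℚ)^2 * (r : ℚ)^3 + 252 * (s : ℚ)^2 * (r : ℚ)^4 + 24165 * (s : ℚ)^3 + 18565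 * (s : ℚ)^3 * (r : ℚ) + 4616 * (s : ℚ)^3 * (r : ℚ)^2 + 366 * (s : ℚ)^3 * (r : ℚ)^3 + 3893 * (s : ℚ)^4 + 2036 * (s : ℚ)^4 * (r : ℚ) + 262 * (s : ℚ)^4 * (r : ℚ)^2 + 327 * (s : ℚ)^5 + 87 * (s : ℚ)^5 * (r : ℚ) + 11 * (s : ℚ)^6) / (((r : ℚ) + 1) * (r + 2) * (r + 3)) ^ 2) := by
  rw [qr0, qr1, qr2]
  field_simp
  ring

/-- The `K₄ ∖ e` coefficient of `A` at the base layer. -/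
lemma k4e_coef (r s : ℕ) (c0 c1 c2 c3 : ℚ)
    (qr2 : c2 = c3 * (r + s + 5) / (r + 1)) (qr1 : c1 = c2 * (r + s + 4) / (r + 2))
    (qr0 : c0 = c1 * (r + s + 3) / (r + 3)) :
    24 * c0 + 56 * c1 - 80 * c3 = c3 * ((4320 + 2880 * (r : ℚ) + 480 * (r : ℚ)^2 + 2640 * (s : ℚ) + 1416 * (s : ℚ) * (r : ℚ) + 184 * (s : ℚ) * (r : ℚ)^2 + 456 * (s : ℚ)^2 + 128 * (s : ℚ)^2 * (r : ℚ) + 24 * (s : ℚ)^3) / (((r : ℚ) + 1) * (r + 2) * (r + 3))) := by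
  rw [qr0, qr1, qr2]
  field_simp
  ring

set_option maxHeartbeats 1600000 in
/-- **THE `K₄ ∖ e` BASE LAYER** (`q = r + 3`, `p = r + s + 5`, `m = K = 2r + s + 5`): `Φ(p,q)·#U ≤ #Y`. -/
lemma k4e_base (r s : ℕ) :
    phiK (r + s + 5) (r + 3) *
        ((14 * (2 * r + s + 5).choose (r + 3 - 3) + 12 * (2 * r + s + 5).choose (r + 3 - 2)
          + 5 * (2 * r + s + 5).choose (r + 3 - 1) + (2 * r + s + 5).choose (r + 3) : ℕ) : ℚ)
      ≤ ((∑ a ∈ Ico (r + 3 + 1) (r + s + 5), (2 * r + s + 5).choose a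
          + 5 * ∑ a ∈ Ico (r + 3) (r + s + 5 - 1), (2 * r + s + 5).choose a
          + 12 * ∑ a ∈ Ico (r + 3 - 1) (r + s + 5 - 2), (2 * r + s + 5).choose a
          + 14 * ∑ a ∈ Ico (r + 3 - 2) (r + s + 5 - 3), (2 * r + s + 5).choose a : ℕ) : ℚ) := by
  set K := 2 * r + s + 5 with hK
  set A := ∑ a ∈ Ico (r + 4) (r + s + 5), K.choose a with hA
  set B := ∑ a ∈ Ico (r + 3) (r + s + 4), K.choose a with hB
  set Cc := ∑ a ∈ Ico (r + 2) (r + s + 3), K.choose a with hCc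
  set D := ∑ a ∈ Ico (r + 1) (r + s + 2), K.choose a with hD
  set c3 := K.choose r with hc3
  set c2 := K.choose (r + 1) with hc2
  set c1 := K.choose (r + 2) with hc1
  set c0 := K.choose (r + 3) with hc0
  have hnum : ∑ u ∈ Ioo (r + 3) (r + s + 5), (K + 3).choose u = A + 3 * B + 3 * Cc + D := k4_num_eq r s
  have hden : (K + 3).choose (r + s + 5) = c3 + 3 * c2 + 3 * c1 + c0 := k4_den_eq r s
  have hphi : phiK (r + s + 5) (r + 3) = ((A + 3 * B + 3 * Cc + D : ℕ) : ℚ) / ((c3 + 3 * c2 + 3 * c1 + c0 : ℕ) : ℚ) := by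
    unfold phiK
    rw [show r + s + 5 + (r + 3) = K + 3 by omega, ← hden, ← hnum, Nat.cast_sum]
  have hU : (14 * K.choose (r + 3 - 3) + 12 * K.choose (r + 3 - 2) + 5 * K.choose (r + 3 - 1) + K.choose (r + 3) : ℕ)
      = 14 * c3 + 12 * c2 + 5 * c1 + c0 := by
    simp only [show r + 3 - 3 = r by omega, show r + 3 - 2 = r + 1 by omega, show r + 3 - 1 = r + 2 by omega]
    rfl
  have hY : (∑ a ∈ Ico (r + 3 + 1) (r + s + 5), K.choose a + 5 * ∑ a ∈ Ico (r + 3) (r + s + 5 - 1), K.choose a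
        + 12 * ∑ a ∈ Ico (r + 3 - 1) (r + s + 5 - 2), K.choose a
        + 14 * ∑ a ∈ Ico (r + 3 - 2) (r + s + 5 - 3), K.choose a : ℕ) = A + 5 * B + 12 * Cc + 14 * D := by
    simp only [show r + 3 + 1 = r + 4 by omega, show r + s + 5 - 1 = r + s + 4 by omega,
      show r + 3 - 1 = r + 2 by omega, show r + s + 5 - 2 = r + s + 3 by omega, show r + 3 - 2 = r + 1 by omega,
      show r + s + 5 - 3 = r + s + 2 by omega]
    rfl
  have hAD : A = D := by
    rw [hA, hD, sum_choose_reflect K (r + 4) (r + s + 5) (by omega)]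
    rw [show K + 1 - (r + s + 5) = r + 1 by omega, show K + 1 - (r + 4) = r + s + 2 by omega]
  have hBC : B = Cc := by
    rw [hB, hCc, sum_choose_reflect K (r + 3) (r + s + 4) (by omega)]
    rw [show K + 1 - (r + s + 4) = r + 2 by omega, show K + 1 - (r + 3) = r + s + 3 by omega]
  have hsym : K.choose (r + s + 4) = c2 := by
    rw [hc2, ← Nat.choose_symm (show r + 1 ≤ K by omega), show K - (r + 1) = r + s + 4 by omega]
  have hBA : B + c2 = A + c0 := by
    rw [hB, hA, Finset.sum_eq_sum_Ico_succ_bot (show r + 3 < r + s + 4 by omega),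
      Finset.sum_Ico_succ_top (show r + 4 ≤ r + s + 4 by omega), hsym, hc0]
    ring
  have hA2 : c2 ≤ A := by
    rw [hA, Finset.sum_Ico_succ_top (show r + 4 ≤ r + s + 4 by omega), hsym]
    exact Nat.le_add_left _ _
  have hc3pos : 0 < c3 := Nat.choose_pos (by omega)
  have r2 : c2 * (r + 1) = c3 * (r + s + 5) := by
    have := choose_ratio K r; rwa [show K - r = r + s + 5 by omega] at this
  have r1 : c1 * (r + 2) = c2 * (r + s + 4) := by
    have := choose_ratio K (r + 1); rwa [show K - (r + 1) = r + s + 4 by omega] at this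
  have r0 : c0 * (r + 3) = c1 * (r + s + 3) := by
    have := choose_ratio K (r + 2); rwa [show K - (r + 2) = r + s + 3 by omega] at this
  rw [hphi, hU, hY]
  have hpos : (0 : ℚ) < ((c3 + 3 * c2 + 3 * c1 + c0 : ℕ) : ℚ) := by exact_mod_cast (by omega : 0 < c3 + 3 * c2 + 3 * c1 + c0)
  rw [div_mul_eq_mul_div, div_le_iff₀ hpos]
  have qAD : (A : ℚ) = D := by exact_mod_cast hAD
  have qBC : (B : ℚ) = Cc := by exact_mod_cast hBC
  have qBA : (B : ℚ) + c2 = A + c0 := by exact_mod_cast hBA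
  have qA2 : (c2 : ℚ) ≤ A := by exact_mod_cast hA2
  have qr2 : (c2 : ℚ) = c3 * (r + s + 5) / (r + 1) := by
    rw [eq_div_iff (by positivity)]; exact_mod_cast r2
  have qr1 : (c1 : ℚ) = c2 * (r + s + 4) / (r + 2) := by
    rw [eq_div_iff (by positivity)]; exact_mod_cast r1
  have qr0 : (c0 : ℚ) = c1 * (r + s + 3) / (r + 3) := by
    rw [eq_div_iff (by positivity)]; exact_mod_cast r0
  have hcoef : (0 : ℚ) ≤ 24 * c0 + 56 * c1 - 80 * c3 := by
    rw [k4e_coef r s c0 c1 c2 c3 qr2 qr1 qr0]; positivity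
  have hH : (0 : ℚ) ≤ c2 * (24 * c0 + 56 * c1 - 80 * c3)
      + (11 * c0 ^ 2 + 21 * c1 * c0 - 32 * c2 * c0 - 21 * c2 * c1 + 21 * c2 ^ 2 - 67 * c3 * c0 + 67 * c3 * c2) := by
    rw [k4e_key r s c0 c1 c2 c3 qr2 qr1 qr0]; positivity
  push_cast
  rw [← qAD, ← qBC]
  have qB : (B : ℚ) = A + c0 - c2 := by linarith
  rw [qB]
  have h2 := add_nonneg hH (mul_nonneg (sub_nonneg.2 qA2) hcoef)
  rw [← sub_nonneg]
  convert h2 using 2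
  ring

end PercRepro.LineLadder
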